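import Mathlib
import Literature.NumberTheory.LFunctions.MertensFormula
import Literature.NumberTheory.LFunctions.MertensElementary
import Literature.NumberTheory.Sieve.AsymptoticSieveForPrimesReduction
import HarnessLib

/-!
# Euler-product bounds for the smooth-part sums (proof of Prop. 4.2, p. 15, (xnx-2))

Trunk AntSieve, tooling toward the named fact `Literature.NumberTheory.Sieve.weakDHL_three_two_of_GEH`
(D. H. J. Polymath, Res. Math. Sci. 1:12 (2014) = arXiv:1407.4897, Theorem 3.2(xii)), here the
last step of the proof of Proposition 4.2, p. 15: "Ignoring the coprimality conditions on the
`d_j` for an upper bound, we see this is bounded by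
`∏_{w<p≤x^{1/10k}} (1 + O(min(σ log_x p, 1))/p Σ_{j≥0} O(1)^j/p^j)^k ≪ exp(O(Σ_{p≤x} min(σ log_x p,1)/p))`.
But from Mertens' theorem we have `Σ_{p≤x} min(σ log_x p,1)/p = O(log σ)`" (the source prints
`O(log(1/σ))`, a typo for `O(1 + log σ)`, `σ ≥ 1`).

* `sum_le_prod_euler` — `Σ_{d ∈ S} f(d) ≤ ∏_{p ∈ Ps} Σ_{a≤A} f(p^a)` for multiplicative `f ≥ 0`
  and `S` a set of divisors of `∏ p^A`;
* the weights `mw σ x p = min(σ log p/log x, 1)`, `Fw c σ x` (`d ↦ c^{Ω(d)} ∏_{p∣d} mw(p) / d`)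
  and `Gw c σ x` (`d ↦ c^{Ω(d)} ∏_{p∣d} mw(p)`), multiplicative;
* `sum_mw_div_le` / `sum_mw_div_le_eps` — Mertens: `Σ_{p ≤ z} mw(p)/p ≤ 27 + log⁺(σ log z/log x)`
  and `Σ_{p ≤ x^ε} mw(p)/p ≤ 26 σ ε + 2σ/log x`;
* `sum_Fw_le`, `sum_Fw_bad_le`, `sum_Gw_le` — the three sums over `d < y`, `(d, W) = 1`.

## References

* [Polymath8b2014] D. H. J. Polymath, Res. Math. Sci. 1 (2014), Art. 12 = arXiv:1407.4897,
  proof of Proposition 4.2, p. 15.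
* [HardyWright2008] G. H. Hardy, E. M. Wright, Thms 425, 427 (Mertens; tree:
  `MertensElementary.lean`, `MertensFormula.lean`).
-/

noncomputable section

open Finset Real Filter
open scoped ArithmeticFunction.Omega ArithmeticFunction.omega ArithmeticFunction.zeta

namespace Literature.NumberTheory.Sieve

open scoped Classical

namespace EulerSums

/-! ### Multiplicative sums are bounded by Euler products -/

/-- **`Σ_{d ∈ S} f(d) ≤ ∏_{p ∈ Ps} Σ_{a ≤ A} f(p^a)`** for a multiplicative `f ≥ 0` and a finite set
`S` of divisors of `∏_{p ∈ Ps} p^A` (`Ps` a finite set of primes). [folklore] -/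
theorem sum_le_prod_euler {f : ArithmeticFunction ℝ} (hf : f.IsMultiplicative) (hf0 : ∀ n, 0 ≤ f n)
    {Ps : Finset ℕ} (hPs : ∀ p ∈ Ps, p.Prime) (A : ℕ) {S : Finset ℕ} (hS : ∀ d ∈ S, d ∣ ∏ p ∈ Ps, p ^ A) :
    ∑ d ∈ S, f d ≤ ∏ p ∈ Ps, ∑ a ∈ Finset.range (A + 1), f (p ^ a) := by
  set N := ∏ p ∈ Ps, p ^ A with hN
  have hN0 : N ≠ 0 := Finset.prod_ne_zero_iff.2 fun p hp => pow_ne_zero _ (hPs p hp).ne_zero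
  have hsub : S ⊆ N.divisors := fun d hd => Nat.mem_divisors.2 ⟨hS d hd, hN0⟩
  have hmul : (f * (ζ : ArithmeticFunction ℝ)).IsMultiplicative := hf.mul ArithmeticFunction.isMultiplicative_zeta.natCast
  calc ∑ d ∈ S, f d ≤ ∑ d ∈ N.divisors, f d := Finset.sum_le_sum_of_subset_of_nonneg hsub fun d _ _ => hf0 d
    _ = (f * (ζ : ArithmeticFunction ℝ)) N := ArithmeticFunction.coe_mul_zeta_apply.symm
    _ = ∏ p ∈ Ps, (f * (ζ : ArithmeticFunction ℝ)) (p ^ A) := by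
        rw [hN]
        exact hmul.map_prod (fun p => p ^ A) Ps fun p hp q hq hpq =>
          (Nat.coprime_pow_primes A A (hPs p hp) (hPs q hq) hpq)
    _ = ∏ p ∈ Ps, ∑ a ∈ Finset.range (A + 1), f (p ^ a) := by
        refine Finset.prod_congr rfl fun p hp => ?_
        rw [ArithmeticFunction.coe_mul_zeta_apply, Nat.sum_divisors_prime_pow (hPs p hp)]

/-- A truncated geometric series: `Σ_{a=1}^{A} r^a ≤ 2r` for `0 ≤ r ≤ 1/2`. [folklore] -/
theorem sum_Icc_pow_le {r : ℝ} (hr0 : 0 ≤ r) (hr : r ≤ 1 / 2) (A : ℕ) : ∑ a ∈ Finset.Icc 1 A, r ^ a ≤ 2 * r := by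
  have hgeom : ∀ n : ℕ, ∑ a ∈ Finset.range n, r ^ a ≤ 2 := fun n => by
    have h := geom_sum_Ico_le_of_lt_one hr0 (by linarith : r < 1) (m := 0) (n := n)
    rw [Finset.range_eq_Ico]
    refine h.trans ?_
    rw [pow_zero, div_le_iff₀ (by linarith)]; linarith
  have heq : ∑ a ∈ Finset.Icc 1 A, r ^ a = r * ∑ a ∈ Finset.range A, r ^ a := by
    rw [Finset.mul_sum]
    have : Finset.Icc 1 A = (Finset.range A).map ⟨fun a => a + 1, fun a b h => by simpa using h⟩ := by
      ext a
      simp only [Finset.mem_Icc, Finset.mem_map, Finset.mem_range, Function.Embedding.coeFn_mk]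
      constructor
      · intro h; exact ⟨a - 1, by omega, by omega⟩
      · rintro ⟨b, hb, rfl⟩; omega
    rw [this, Finset.sum_map]
    refine Finset.sum_congr rfl fun a _ => ?_
    simp [pow_succ, mul_comm]
  rw [heq]
  calc r * ∑ a ∈ Finset.range A, r ^ a ≤ r * 2 := mul_le_mul_of_nonneg_left (hgeom A) hr0
    _ = 2 * r := by ring

/-! ### The weights -/

/-- `mw σ x p = min(σ log p / log x, 1)`. [cite: Polymath8b2014, proof of Prop. 4.2, p. 15] -/
def mw (σ x : ℝ) (p : ℕ) : ℝ := min (σ * (Real.log p / Real.log x)) 1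

/-- `0 ≤ mw ≤ 1` for `σ ≥ 0`, `x ≥ 1`, `p ≥ 1`. [folklore] -/
theorem mw_nonneg {σ x : ℝ} (hσ : 0 ≤ σ) (hx : 1 ≤ x) (p : ℕ) : 0 ≤ mw σ x p := by
  unfold mw
  refine le_min ?_ zero_le_one
  rcases Nat.eq_zero_or_pos p with rfl | hp
  · simp
  · exact mul_nonneg hσ (div_nonneg (Real.log_nonneg (by exact_mod_cast hp)) (Real.log_nonneg hx))

/-- `mw ≤ 1`. [folklore] -/
theorem mw_le_one (σ x : ℝ) (p : ℕ) : mw σ x p ≤ 1 := min_le_right _ _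

/-- `mw ≤ σ log p / log x`. [folklore] -/
theorem mw_le_mul {σ x : ℝ} (p : ℕ) : mw σ x p ≤ σ * (Real.log p / Real.log x) := min_le_left _ _

/-- The weight `F(d) = c^{Ω(d)} ∏_{p ∣ d} mw(p) / d` (zero at `0`). [cite: Polymath8b2014, proof of Prop. 4.2, p. 15] -/
def Fw (c σ x : ℝ) : ArithmeticFunction ℝ :=
  ⟨fun d => if d = 0 then 0 else c ^ Ω d * (∏ p ∈ d.primeFactors, mw σ x p) / d, if_pos rfl⟩

/-- The weight `G(d) = c^{Ω(d)} ∏_{p ∣ d} mw(p)` (zero at `0`). [cite: Polymath8b2014, proof of Prop. 4.2, p. 15] -/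
def Gw (c σ x : ℝ) : ArithmeticFunction ℝ :=
  ⟨fun d => if d = 0 then 0 else c ^ Ω d * ∏ p ∈ d.primeFactors, mw σ x p, if_pos rfl⟩

/-- Unfolding `F` at `d ≠ 0`. [folklore] -/
theorem Fw_apply {c σ x : ℝ} {d : ℕ} (hd : d ≠ 0) : Fw c σ x d = c ^ Ω d * (∏ p ∈ d.primeFactors, mw σ x p) / d := by
  rw [Fw, ArithmeticFunction.coe_mk, if_neg hd]

/-- Unfolding `G` at `d ≠ 0`. [folklore] -/
theorem Gw_apply {c σ x : ℝ} {d : ℕ} (hd : d ≠ 0) : Gw c σ x d = c ^ Ω d * ∏ p ∈ d.primeFactors, mw σ x p := by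
  rw [Gw, ArithmeticFunction.coe_mk, if_neg hd]

/-- `F(d) = G(d)/d`. [folklore] -/
theorem Fw_eq_Gw_div {c σ x : ℝ} (d : ℕ) : Fw c σ x d = Gw c σ x d / d := by
  rcases eq_or_ne d 0 with rfl | hd
  · simp [Fw, Gw]
  · rw [Fw_apply hd, Gw_apply hd]

/-- `0 ≤ G`. [folklore] -/
theorem Gw_nonneg {c σ x : ℝ} (hc : 0 ≤ c) (hσ : 0 ≤ σ) (hx : 1 ≤ x) (d : ℕ) : 0 ≤ Gw c σ x d := by
  rcases eq_or_ne d 0 with rfl | hd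
  · simp [Gw]
  · rw [Gw_apply hd]; exact mul_nonneg (pow_nonneg hc _) (Finset.prod_nonneg fun p _ => mw_nonneg hσ hx p)

/-- `0 ≤ F`. [folklore] -/
theorem Fw_nonneg {c σ x : ℝ} (hc : 0 ≤ c) (hσ : 0 ≤ σ) (hx : 1 ≤ x) (d : ℕ) : 0 ≤ Fw c σ x d := by
  rw [Fw_eq_Gw_div]; exact div_nonneg (Gw_nonneg hc hσ hx d) (Nat.cast_nonneg _)

/-- `G` is multiplicative. [folklore] -/
theorem isMultiplicative_Gw (c σ x : ℝ) : (Gw c σ x).IsMultiplicative := by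
  refine ⟨by rw [Gw_apply one_ne_zero]; simp, fun {m n} hmn => ?_⟩
  rcases eq_or_ne m 0 with rfl | hm
  · simp [Gw]
  rcases eq_or_ne n 0 with rfl | hn
  · simp [Gw]
  rw [Gw_apply (mul_ne_zero hm hn), Gw_apply hm, Gw_apply hn, ArithmeticFunction.cardFactors_mul hm hn, pow_add,
    Nat.Coprime.primeFactors_mul hmn, Finset.prod_union hmn.disjoint_primeFactors]
  ring

/-- `F` is multiplicative. [folklore] -/
theorem isMultiplicative_Fw (c σ x : ℝ) : (Fw c σ x).IsMultiplicative := by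
  refine ⟨by rw [Fw_eq_Gw_div, (isMultiplicative_Gw c σ x).map_one]; simp, fun {m n} hmn => ?_⟩
  rw [Fw_eq_Gw_div, Fw_eq_Gw_div, Fw_eq_Gw_div, (isMultiplicative_Gw c σ x).map_mul_of_coprime hmn, Nat.cast_mul,
    mul_div_mul_comm]

/-- `G(p^a) = c^a mw(p)` for `a ≥ 1`. [folklore] -/
theorem Gw_prime_pow {c σ x : ℝ} {p : ℕ} (hp : p.Prime) {a : ℕ} (ha : a ≠ 0) : Gw c σ x (p ^ a) = c ^ a * mw σ x p := by
  rw [Gw_apply (pow_ne_zero _ hp.ne_zero), ArithmeticFunction.cardFactors_apply_prime_pow hp, Nat.primeFactors_prime_pow ha hp,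
    Finset.prod_singleton]

/-- `F(p^a) = (c/p)^a mw(p)` for `a ≥ 1`. [folklore] -/
theorem Fw_prime_pow {c σ x : ℝ} {p : ℕ} (hp : p.Prime) {a : ℕ} (ha : a ≠ 0) : Fw c σ x (p ^ a) = (c / p) ^ a * mw σ x p := by
  rw [Fw_eq_Gw_div, Gw_prime_pow hp ha, Nat.cast_pow, div_pow]; ring

/-- **The Euler factor**: for `p ≥ 2c` (`c ≥ 0`), `Σ_{a ≤ A} F(p^a) ≤ 1 + 2c mw(p)/p`. [cite: Polymath8b2014, proof of Prop. 4.2, p. 15] -/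
theorem euler_factor_le {c σ x : ℝ} (hc : 0 ≤ c) (hσ : 0 ≤ σ) (hx : 1 ≤ x) {p : ℕ} (hp : p.Prime) (hcp : 2 * c ≤ p) (A : ℕ) :
    ∑ a ∈ Finset.range (A + 1), Fw c σ x (p ^ a) ≤ 1 + 2 * c * mw σ x p / p := by
  have hp0 : (0 : ℝ) < p := by exact_mod_cast hp.pos
  rw [Finset.range_eq_Ico, Finset.sum_eq_sum_Ico_succ_bot (Nat.succ_pos A), pow_zero, (isMultiplicative_Fw c σ x).map_one]
  have hIco : Finset.Ico (0 + 1) A.succ = Finset.Icc 1 A := by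
    ext a; simp only [Finset.mem_Ico, Finset.mem_Icc, Nat.succ_eq_add_one]; omega
  rw [hIco]
  gcongr
  calc ∑ a ∈ Finset.Icc 1 A, Fw c σ x (p ^ a) = ∑ a ∈ Finset.Icc 1 A, (c / p) ^ a * mw σ x p :=
        Finset.sum_congr rfl fun a ha => Fw_prime_pow hp (by have := (Finset.mem_Icc.1 ha).1; omega)
    _ = (∑ a ∈ Finset.Icc 1 A, (c / p) ^ a) * mw σ x p := by rw [Finset.sum_mul]
    _ ≤ (2 * (c / p)) * mw σ x p := by
        refine mul_le_mul_of_nonneg_right (sum_Icc_pow_le (div_nonneg hc hp0.le) ?_ A) (mw_nonneg hσ hx p)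
        rw [div_le_iff₀ hp0]; linarith
    _ = 2 * c * mw σ x p / p := by ring

/-! ### Mertens: `Σ_{p ≤ z} min(σ log p/log x, 1)/p` -/

section MertensBounds

open Literature.NumberTheory.LFunctions

/-- (M1) `Σ_{p ≤ z} mw(p)/p ≤ σ (log z + log 4)/log x` (`z ≥ 1`, `x > 1`, `σ ≥ 0`). [folklore] -/
theorem sum_mw_div_le_linear {σ x z : ℝ} (hσ : 0 ≤ σ) (hx : 1 < x) (hz : 1 ≤ z) :
    ∑ p ∈ Nat.primesLE ⌊z⌋₊, mw σ x p / p ≤ σ * (Real.log z + Real.log 4) / Real.log x := by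
  have hlogx : 0 < Real.log x := Real.log_pos hx
  have hfl : (1 : ℝ) ≤ ⌊z⌋₊ := by exact_mod_cast Nat.le_floor (by exact_mod_cast hz)
  calc ∑ p ∈ Nat.primesLE ⌊z⌋₊, mw σ x p / p ≤ ∑ p ∈ Nat.primesLE ⌊z⌋₊, σ / Real.log x * (Real.log p / p) := by
        refine Finset.sum_le_sum fun p hp => ?_
        have hp0 : (0 : ℝ) < p := by exact_mod_cast (Nat.mem_primesLE.1 hp).2.pos
        rw [div_le_iff₀ hp0]
        refine (mw_le_mul p).trans (le_of_eq ?_)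
        field_simp
    _ = σ / Real.log x * ∑ p ∈ Nat.primesLE ⌊z⌋₊, Real.log p / p := by rw [Finset.mul_sum]
    _ ≤ σ / Real.log x * (Real.log ⌊z⌋₊ + Real.log 4) :=
        mul_le_mul_of_nonneg_left (MertensBound.sum_log_div_prime_le _) (div_nonneg hσ hlogx.le)
    _ ≤ σ / Real.log x * (Real.log z + Real.log 4) := by
        apply mul_le_mul_of_nonneg_left _ (div_nonneg hσ hlogx.le)
        have := Real.log_le_log (by linarith : (0 : ℝ) < ⌊z⌋₊) (Nat.floor_le (by linarith))
        linarith
    _ = σ * (Real.log z + Real.log 4) / Real.log x := by ring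

/-- (M2) A window of prime reciprocals: `Σ_{a < p ≤ b} 1/p ≤ log(log b/log a) + 16/log a` for `2 ≤ a ≤ b`.
[cite: HardyWright2008, Thm 427] -/
theorem sum_inv_window_le {a b : ℝ} (ha : 2 ≤ a) (hab : a ≤ b) :
    ∑ p ∈ Nat.primesLE ⌊b⌋₊ \ Nat.primesLE ⌊a⌋₊, (p : ℝ)⁻¹ ≤ Real.log (Real.log b / Real.log a) + 16 / Real.log a := by
  have hloga : 0 < Real.log a := Real.log_pos (by linarith)
  have hlogb : 0 < Real.log b := Real.log_pos (by linarith)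
  have hsub : Nat.primesLE ⌊a⌋₊ ⊆ Nat.primesLE ⌊b⌋₊ := fun p hp => by
    rw [Nat.mem_primesLE] at hp ⊢; exact ⟨hp.1.trans (Nat.floor_le_floor hab), hp.2⟩
  have hdiff : ∑ p ∈ Nat.primesLE ⌊b⌋₊ \ Nat.primesLE ⌊a⌋₊, (p : ℝ)⁻¹ = Mertens.primeRecipSum b - Mertens.primeRecipSum a := by
    rw [Mertens.primeRecipSum, Mertens.primeRecipSum, ← Finset.sum_sdiff hsub]; ring
  have hb := Mertens.abs_primeRecipSum_sub_le (x := b) (by linarith)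
  have ha' := Mertens.abs_primeRecipSum_sub_le (x := a) ha
  rw [abs_le] at hb ha'
  rw [hdiff, Real.log_div hlogb.ne' hloga.ne']
  have h8 : 8 / Real.log b ≤ 8 / Real.log a := div_le_div_of_nonneg_left (by norm_num) hloga (Real.log_le_log (by linarith) hab)
  have h16 : 16 / Real.log a = 8 / Real.log a + 8 / Real.log a := by ring
  linarith [hb.2, ha'.1]

/-- (M3) **`Σ_{p ≤ z} mw(p)/p ≤ 28 + log⁺(σ log z / log x)`** (`σ ≥ 1`, `x ≥ 2`, `z ≥ 2`).
[cite: Polymath8b2014, proof of Prop. 4.2, p. 15] -/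
theorem sum_mw_div_le_log {σ x z : ℝ} (hσ : 1 ≤ σ) (hx : 2 ≤ x) (hz : 2 ≤ z) :
    ∑ p ∈ Nat.primesLE ⌊z⌋₊, mw σ x p / p ≤ 28 + max 0 (Real.log (σ * Real.log z / Real.log x)) := by
  have hlogx : 0 < Real.log x := Real.log_pos (by linarith)
  have hlogz : 0 < Real.log z := Real.log_pos (by linarith)
  have hlog2 : (0.6931471803 : ℝ) < Real.log 2 := Real.log_two_gt_d9
  have hlog4 : Real.log 4 = 2 * Real.log 2 := by
    rw [show (4 : ℝ) = 2 ^ 2 by norm_num, Real.log_pow]; norm_num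
  have hmax0 : 0 ≤ max 0 (Real.log (σ * Real.log z / Real.log x)) := le_max_left _ _
  set a := x ^ (1 / σ) with ha
  have hx0 : 0 < x := by linarith
  have ha1 : 1 ≤ a := Real.one_le_rpow (by linarith) (by positivity)
  have hloga : Real.log a = Real.log x / σ := by rw [ha, Real.log_rpow hx0]; ring
  -- the part `p ≤ min(z, a)` via (M1)
  have hsmall : ∀ t : ℝ, 1 ≤ t → t ≤ a → ∑ p ∈ Nat.primesLE ⌊t⌋₊, mw σ x p / p ≤ 3 := by
    intro t ht hta
    rcases lt_or_ge t 2 with ht2 | ht2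
    · -- no primes `≤ t`
      have : Nat.primesLE ⌊t⌋₊ = ∅ := by
        have hfl : ⌊t⌋₊ ≤ 1 := Nat.le_of_lt_succ ((Nat.floor_lt (by linarith)).2 (by norm_num; linarith))
        ext p; simp only [Nat.mem_primesLE, Finset.notMem_empty, iff_false, not_and]
        intro hp hpp; exact absurd (hpp.two_le.trans (hp.trans hfl)) (by norm_num)
      rw [this, Finset.sum_empty]; norm_num
    · have h1 := sum_mw_div_le_linear (σ := σ) (x := x) (by linarith) (by linarith) ht
      -- `σ log t ≤ σ log a = log x` and `σ ≤ log x / log 2` (as `a ≥ t ≥ 2`)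
      have hσt : σ * Real.log t ≤ Real.log x := by
        calc σ * Real.log t ≤ σ * Real.log a := mul_le_mul_of_nonneg_left (Real.log_le_log (by linarith) hta) (by linarith)
          _ = Real.log x := by rw [hloga]; field_simp
      have hσ2 : σ * Real.log 2 ≤ Real.log x :=
        le_trans (mul_le_mul_of_nonneg_left (Real.log_le_log (by norm_num) ht2) (by linarith)) hσt
      refine h1.trans ?_
      rw [div_le_iff₀ hlogx, hlog4]
      nlinarith
  rcases le_or_gt z a with hza | hza
  · exact (hsmall z (by linarith) hza).trans (by linarith)
  · -- split at `a`
    have hsub : Nat.primesLE ⌊a⌋₊ ⊆ Nat.primesLE ⌊z⌋₊ := fun p hp => by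
      rw [Nat.mem_primesLE] at hp ⊢; exact ⟨hp.1.trans (Nat.floor_le_floor hza.le), hp.2⟩
    rw [← Finset.sum_sdiff hsub]
    have hbig : ∑ p ∈ Nat.primesLE ⌊z⌋₊ \ Nat.primesLE ⌊a⌋₊, mw σ x p / p ≤ 25 + max 0 (Real.log (σ * Real.log z / Real.log x)) := by
      have hle1 : ∑ p ∈ Nat.primesLE ⌊z⌋₊ \ Nat.primesLE ⌊a⌋₊, mw σ x p / p ≤ ∑ p ∈ Nat.primesLE ⌊z⌋₊ \ Nat.primesLE ⌊a⌋₊, (p : ℝ)⁻¹ := by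
        refine Finset.sum_le_sum fun p hp => ?_
        have hp0 : (0 : ℝ) < p := by exact_mod_cast (Nat.mem_primesLE.1 (Finset.mem_sdiff.1 hp).1).2.pos
        rw [div_le_iff₀ hp0, inv_mul_cancel₀ hp0.ne']; exact mw_le_one σ x p
      refine hle1.trans ?_
      rcases le_or_gt 2 a with ha2 | ha2
      · have hw := sum_inv_window_le ha2 hza.le
        have hlogaz : Real.log (Real.log z / Real.log a) = Real.log (σ * Real.log z / Real.log x) := by
          rw [hloga]; congr 1; field_simp
        have hloga0 : Real.log 2 ≤ Real.log a := Real.log_le_log (by norm_num) ha2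
        have h16 : 16 / Real.log a ≤ 16 / Real.log 2 := div_le_div_of_nonneg_left (by norm_num) (by linarith) hloga0
        have h162 : 16 / Real.log 2 ≤ 24 := by rw [div_le_iff₀ (by linarith)]; linarith
        rw [hlogaz] at hw
        linarith [le_max_right 0 (Real.log (σ * Real.log z / Real.log x))]
      · -- `a < 2`: the window from `2`, plus the prime `2`
        have hsub2 : Nat.primesLE ⌊z⌋₊ \ Nat.primesLE ⌊a⌋₊ ⊆ Nat.primesLE ⌊z⌋₊ := Finset.sdiff_subset
        have hsplit2 : ∑ p ∈ Nat.primesLE ⌊z⌋₊, (p : ℝ)⁻¹ =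
            ∑ p ∈ Nat.primesLE ⌊z⌋₊ \ Nat.primesLE ⌊(2:ℝ)⌋₊, (p : ℝ)⁻¹ + ∑ p ∈ Nat.primesLE ⌊(2:ℝ)⌋₊, (p : ℝ)⁻¹ := by
          rw [Finset.sum_sdiff]
          intro p hp; rw [Nat.mem_primesLE] at hp ⊢; exact ⟨hp.1.trans (Nat.floor_le_floor hz), hp.2⟩
        have h2set : Nat.primesLE ⌊(2:ℝ)⌋₊ = {2} := by
          rw [show ⌊(2:ℝ)⌋₊ = 2 by norm_num]; decide
        have hw := sum_inv_window_le (le_refl (2:ℝ)) hz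
        -- `σ > log x / log 2`, so `log(log z / log 2) ≤ log (σ log z / log x)`
        have hσbig : Real.log x / Real.log 2 < σ := by
          by_contra hcon
          push Not at hcon
          rw [le_div_iff₀ (by linarith)] at hcon
          have hlog2a : Real.log 2 ≤ Real.log a := by
            rw [hloga, le_div_iff₀ (by linarith)]; linarith
          have : (2 : ℝ) ≤ a := (Real.log_le_log_iff (by norm_num) (by linarith)).1 hlog2a
          linarith
        have hlogcmp : Real.log (Real.log z / Real.log 2) ≤ Real.log (σ * Real.log z / Real.log x) := by
          refine Real.log_le_log (by positivity) ?_
          rw [div_le_div_iff₀ (by linarith) hlogx]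
          rw [div_lt_iff₀ (by linarith)] at hσbig
          nlinarith
        have h162 : 16 / Real.log 2 ≤ 24 := by rw [div_le_iff₀ (by linarith)]; linarith
        calc ∑ p ∈ Nat.primesLE ⌊z⌋₊ \ Nat.primesLE ⌊a⌋₊, (p : ℝ)⁻¹ ≤ ∑ p ∈ Nat.primesLE ⌊z⌋₊, (p : ℝ)⁻¹ :=
              Finset.sum_le_sum_of_subset_of_nonneg hsub2 fun p _ _ => by positivity
          _ = ∑ p ∈ Nat.primesLE ⌊z⌋₊ \ Nat.primesLE ⌊(2:ℝ)⌋₊, (p : ℝ)⁻¹ + 2⁻¹ := by rw [hsplit2, h2set, Finset.sum_singleton]; norm_num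
          _ ≤ Real.log (Real.log z / Real.log 2) + 16 / Real.log 2 + 2⁻¹ := by linarith
          _ ≤ 25 + max 0 (Real.log (σ * Real.log z / Real.log x)) := by
              linarith [le_max_right 0 (Real.log (σ * Real.log z / Real.log x))]
    linarith [hsmall a ha1 le_rfl]

/-- (M4) **`Σ_{p ≤ z} mw(p)/p ≤ 27 σ log z/log x + 2σ/log x`** (`σ ≥ 1`, `x ≥ 2`, `z ≥ 2`): the linear
form used for the small primes `p ≤ x^ε`. [cite: Polymath8b2014, proof of Prop. 4.2, pp. 15–16] -/
theorem sum_mw_div_le_lin {σ x z : ℝ} (hσ : 1 ≤ σ) (hx : 2 ≤ x) (hz : 2 ≤ z) :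
    ∑ p ∈ Nat.primesLE ⌊z⌋₊, mw σ x p / p ≤ 27 * (σ * Real.log z / Real.log x) + 2 * σ / Real.log x := by
  have hlogx : 0 < Real.log x := Real.log_pos (by linarith)
  have hlogz : 0 < Real.log z := Real.log_pos (by linarith)
  have hlog2 : (0.6931471803 : ℝ) < Real.log 2 := Real.log_two_gt_d9
  have hlog4 : Real.log 4 = 2 * Real.log 2 := by
    rw [show (4 : ℝ) = 2 ^ 2 by norm_num, Real.log_pow]; norm_num
  have hlog4' : Real.log 4 ≤ 2 := by
    have : Real.log 2 ≤ 1 := by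
      have := Real.log_le_sub_one_of_pos (by norm_num : (0:ℝ) < 2); linarith
    linarith
  have hε' : 0 < σ * Real.log z / Real.log x := by positivity
  have hM1 := sum_mw_div_le_linear (σ := σ) (x := x) (z := z) (by linarith) (by linarith) (by linarith)
  -- (M1) gives `σ log z/log x + σ log 4/log x ≤ σ log z / log x + 2σ/log x`
  have hM1' : ∑ p ∈ Nat.primesLE ⌊z⌋₊, mw σ x p / p ≤ σ * Real.log z / Real.log x + 2 * σ / Real.log x := by
    refine hM1.trans ?_
    have h4 : σ * Real.log 4 / Real.log x ≤ 2 * σ / Real.log x := by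
      rw [div_le_div_iff_of_pos_right hlogx]; nlinarith
    have : σ * (Real.log z + Real.log 4) / Real.log x = σ * Real.log z / Real.log x + σ * Real.log 4 / Real.log x := by ring
    linarith
  rcases le_or_gt (σ * Real.log z / Real.log x) 1 with hcase | hcase
  · linarith
  · -- `σ log z > log x`: use (M3): `28 + log(σ log z/log x) ≤ 27 (σ log z/log x) + …`
    have hM3 := sum_mw_div_le_log hσ hx hz
    have hlogt : Real.log (σ * Real.log z / Real.log x) ≤ σ * Real.log z / Real.log x - 1 :=
      Real.log_le_sub_one_of_pos hε'
    have hmax : max 0 (Real.log (σ * Real.log z / Real.log x)) ≤ σ * Real.log z / Real.log x - 1 := by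
      refine max_le (by linarith) hlogt
    have h2σ : 0 ≤ 2 * σ / Real.log x := by positivity
    nlinarith

end MertensBounds

/-! ### The sums over `d ≤ y` coprime to `W` -/

section DSums

/-- The range of the smooth parts: `1 ≤ d ≤ y`, `(d, W) = 1`. [cite: Polymath8b2014, proof of Prop. 4.2, p. 15] -/
def Dset (W : ℕ) (y : ℝ) : Finset ℕ := (Finset.Icc 1 ⌊y⌋₊).filter fun d => d.Coprime W

/-- Membership in `Dset`. [folklore] -/
theorem mem_Dset {W : ℕ} {y : ℝ} {d : ℕ} : d ∈ Dset W y ↔ (1 ≤ d ∧ d ≤ ⌊y⌋₊) ∧ d.Coprime W := by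
  rw [Dset, Finset.mem_filter, Finset.mem_Icc]

/-- Every `d ∈ Dset` divides `∏_{p ≤ y, p ∤ W} p^{⌊y⌋}`. [folklore] -/
theorem dvd_prod_pow_of_mem_Dset {W : ℕ} {y : ℝ} {d : ℕ} (hd : d ∈ Dset W y) :
    d ∣ ∏ p ∈ (Nat.primesLE ⌊y⌋₊).filter (fun p => ¬ p ∣ W), p ^ ⌊y⌋₊ := by
  rw [mem_Dset] at hd
  obtain ⟨⟨hd1, hdy⟩, hcop⟩ := hd
  have hd0 : d ≠ 0 := by omega
  set Ps := (Nat.primesLE ⌊y⌋₊).filter (fun p => ¬ p ∣ W) with hPs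
  have hN0 : ∏ p ∈ Ps, p ^ ⌊y⌋₊ ≠ 0 := Finset.prod_ne_zero_iff.2 fun p hp =>
    pow_ne_zero _ (Nat.mem_primesLE.1 (Finset.mem_filter.1 hp).1).2.ne_zero
  rw [← Nat.factorization_le_iff_dvd hd0 hN0]
  intro p
  rw [Nat.factorization_prod fun q hq => pow_ne_zero _ (Nat.mem_primesLE.1 (Finset.mem_filter.1 hq).1).2.ne_zero]
  simp only [Finsupp.coe_finsetSum, Finset.sum_apply, Nat.factorization_pow]
  by_cases hp : p.Prime ∧ p ∣ d
  · obtain ⟨hpp, hpd⟩ := hp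
    have hpW : ¬ p ∣ W := fun h => hpp.one_lt.ne' (Nat.Coprime.eq_one_of_dvd (hcop.coprime_dvd_left hpd) h)
    have hpPs : p ∈ Ps := Finset.mem_filter.2 ⟨Nat.mem_primesLE.2 ⟨(Nat.le_of_dvd (by omega) hpd).trans hdy, hpp⟩, hpW⟩
    calc d.factorization p ≤ ⌊y⌋₊ := ((Nat.factorization_lt p hd0).le).trans (by omega)
      _ = (⌊y⌋₊ • (Nat.factorization p)) p := by simp [hpp.factorization_self]
      _ ≤ ∑ q ∈ Ps, (⌊y⌋₊ • q.factorization) p := by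
          refine Finset.single_le_sum (f := fun q => (⌊y⌋₊ • q.factorization) p) (fun q _ => by positivity) hpPs
  · have : d.factorization p = 0 := by
      rcases not_and_or.1 hp with h | h
      · exact Nat.factorization_eq_zero_of_not_prime d h
      · exact Nat.factorization_eq_zero_of_not_dvd h
    rw [this]; positivity

variable {W : ℕ} {c σ x y : ℝ}

/-- (S1) **`Σ_{d ∈ Dset} F(d) ≤ exp(2c Σ_{p ≤ y} mw(p)/p)`** when every prime `p ∤ W` has `p ≥ 2c`.
[cite: Polymath8b2014, proof of Prop. 4.2, p. 15] -/
theorem sum_Fw_le (hc : 0 ≤ c) (hσ : 0 ≤ σ) (hx : 1 ≤ x) (hWc : ∀ p : ℕ, p.Prime → ¬ p ∣ W → 2 * c ≤ p) :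
    ∑ d ∈ Dset W y, Fw c σ x d ≤ Real.exp (2 * c * ∑ p ∈ Nat.primesLE ⌊y⌋₊, mw σ x p / p) := by
  set Ps := (Nat.primesLE ⌊y⌋₊).filter (fun p => ¬ p ∣ W) with hPs
  have hPs : ∀ p ∈ Ps, p.Prime ∧ ¬ p ∣ W := fun p hp => ⟨(Nat.mem_primesLE.1 (Finset.mem_filter.1 hp).1).2, (Finset.mem_filter.1 hp).2⟩
  have h1 := sum_le_prod_euler (isMultiplicative_Fw c σ x) (Fw_nonneg hc hσ hx) (fun p hp => (hPs p hp).1) ⌊y⌋₊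
    (S := Dset W y) fun d hd => dvd_prod_pow_of_mem_Dset hd
  refine h1.trans ?_
  calc ∏ p ∈ Ps, ∑ a ∈ Finset.range (⌊y⌋₊ + 1), Fw c σ x (p ^ a) ≤ ∏ p ∈ Ps, (1 + 2 * c * mw σ x p / p) :=
        Finset.prod_le_prod (fun p _ => Finset.sum_nonneg fun a _ => Fw_nonneg hc hσ hx _) fun p hp =>
          euler_factor_le hc hσ hx (hPs p hp).1 (hWc p (hPs p hp).1 (hPs p hp).2) _
    _ ≤ Real.exp (∑ p ∈ Ps, 2 * c * mw σ x p / p) := prod_one_add_le_exp_sum Ps fun p _ => by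
        have := mw_nonneg hσ hx p; positivity
    _ ≤ Real.exp (2 * c * ∑ p ∈ Nat.primesLE ⌊y⌋₊, mw σ x p / p) := by
        refine Real.exp_le_exp.2 ?_
        rw [Finset.mul_sum]
        simp_rw [mul_div_assoc]
        exact Finset.sum_le_sum_of_subset_of_nonneg (Finset.filter_subset _ _) fun p _ _ => by
          have := mw_nonneg hσ hx p; positivity

/-- The fibre over a prime `q`: `Σ_{d ∈ Dset, q ∣ d} F(d) ≤ (2c mw(q)/q) Σ_{d ∈ Dset} F(d)`. [folklore] -/
theorem sum_Fw_dvd_le (hc : 0 ≤ c) (hσ : 0 ≤ σ) (hx : 1 ≤ x) {q : ℕ} (hq : q.Prime) (hcq : 2 * c ≤ q) :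
    ∑ d ∈ (Dset W y).filter (fun d => q ∣ d), Fw c σ x d ≤ (2 * c * mw σ x q / q) * ∑ d ∈ Dset W y, Fw c σ x d := by
  set F := Fw c σ x with hF
  have hF0 : ∀ n, 0 ≤ F n := Fw_nonneg hc hσ hx
  set A := ⌊y⌋₊ with hA
  -- the map `d ↦ (v_q(d), d / q^{v_q(d)})`
  set φ : ℕ → ℕ × ℕ := fun d => (d.factorization q, d / q ^ d.factorization q) with hφ
  have hdecomp : ∀ d : ℕ, q ^ d.factorization q * (d / q ^ d.factorization q) = d := fun d => Nat.ordProj_mul_ordCompl_eq_self d q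
  have hmem : ∀ d ∈ (Dset W y).filter (fun d => q ∣ d), φ d ∈ Finset.Icc 1 A ×ˢ Dset W y := by
    intro d hd
    obtain ⟨hd, hqd⟩ := Finset.mem_filter.1 hd
    rw [mem_Dset] at hd
    obtain ⟨⟨hd1, hdA⟩, hcop⟩ := hd
    have hd0 : d ≠ 0 := by omega
    rw [Finset.mem_product, Finset.mem_Icc, mem_Dset]
    refine ⟨⟨hq.factorization_pos_of_dvd hd0 hqd, ((Nat.factorization_lt q hd0).le).trans (by omega)⟩, ⟨?_, ?_⟩, ?_⟩
    · exact Nat.ordCompl_pos q hd0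
    · exact (Nat.ordCompl_le d q).trans hdA
    · exact hcop.coprime_dvd_left (Nat.ordCompl_dvd d q)
  have hinj : Set.InjOn φ ((Dset W y).filter (fun d => q ∣ d) : Set ℕ) := by
    intro d _ d' _ h
    simp only [hφ, Prod.mk.injEq] at h
    obtain ⟨h1, h2⟩ := h
    calc d = q ^ d.factorization q * (d / q ^ d.factorization q) := (hdecomp d).symm
      _ = q ^ d'.factorization q * (d' / q ^ d'.factorization q) := by rw [h2, h1]
      _ = d' := hdecomp d'
  have hval : ∀ d ∈ (Dset W y).filter (fun d => q ∣ d), F d = F (q ^ (φ d).1) * F (φ d).2 := by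
    intro d hd
    obtain ⟨hd, -⟩ := Finset.mem_filter.1 hd
    have hd0 : d ≠ 0 := by rw [mem_Dset] at hd; omega
    conv_lhs => rw [← hdecomp d]
    exact (isMultiplicative_Fw c σ x).map_mul_of_coprime ((Nat.coprime_ordCompl hq hd0).pow_left _)
  calc ∑ d ∈ (Dset W y).filter (fun d => q ∣ d), F d
      = ∑ d ∈ (Dset W y).filter (fun d => q ∣ d), F (q ^ (φ d).1) * F (φ d).2 := Finset.sum_congr rfl hval
    _ = ∑ z ∈ ((Dset W y).filter (fun d => q ∣ d)).image φ, F (q ^ z.1) * F z.2 := by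
        rw [Finset.sum_image fun d hd d' hd' h => hinj hd hd' h]
    _ ≤ ∑ z ∈ Finset.Icc 1 A ×ˢ Dset W y, F (q ^ z.1) * F z.2 :=
        Finset.sum_le_sum_of_subset_of_nonneg (Finset.image_subset_iff.2 hmem) fun z _ _ => mul_nonneg (hF0 _) (hF0 _)
    _ = (∑ a ∈ Finset.Icc 1 A, F (q ^ a)) * ∑ e ∈ Dset W y, F e := by rw [Finset.sum_product, Finset.sum_mul_sum]
    _ ≤ (2 * c * mw σ x q / q) * ∑ e ∈ Dset W y, F e := by
        refine mul_le_mul_of_nonneg_right ?_ (Finset.sum_nonneg fun e _ => hF0 e)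
        have h := euler_factor_le hc hσ hx hq hcq A
        rw [Finset.range_eq_Ico, Finset.sum_eq_sum_Ico_succ_bot (Nat.succ_pos A), pow_zero, (isMultiplicative_Fw c σ x).map_one] at h
        have hIco : Finset.Ico (0 + 1) A.succ = Finset.Icc 1 A := by
          ext a; simp only [Finset.mem_Ico, Finset.mem_Icc, Nat.succ_eq_add_one]; omega
        rw [hIco] at h
        linarith

/-- (S2) **The bad `d`** (a prime factor `q ≤ z`):
`Σ_{d ∈ Dset, ∃ q ≤ z prime, q ∣ d} F(d) ≤ 2c (Σ_{q ≤ z} mw(q)/q) Σ_{d ∈ Dset} F(d)`. [cite: Polymath8b2014, proof of Prop. 4.2, pp. 15–16] -/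
theorem sum_Fw_bad_le (hc : 0 ≤ c) (hσ : 0 ≤ σ) (hx : 1 ≤ x) (hWc : ∀ p : ℕ, p.Prime → ¬ p ∣ W → 2 * c ≤ p) (z : ℝ) :
    ∑ d ∈ (Dset W y).filter (fun d => ∃ q : ℕ, q.Prime ∧ q ∣ d ∧ (q : ℝ) ≤ z), Fw c σ x d ≤
      2 * c * (∑ q ∈ Nat.primesLE ⌊z⌋₊, mw σ x q / q) * ∑ d ∈ Dset W y, Fw c σ x d := by
  set F := Fw c σ x with hF
  have hF0 : ∀ n, 0 ≤ F n := Fw_nonneg hc hσ hx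
  set Bad := (Dset W y).filter (fun d => ∃ q : ℕ, q.Prime ∧ q ∣ d ∧ (q : ℝ) ≤ z) with hBad
  -- union bound over the small prime factor
  have h1 : ∑ d ∈ Bad, F d ≤ ∑ d ∈ Bad, ∑ q ∈ (Nat.primesLE ⌊z⌋₊).filter (fun q => q ∣ d), F d := by
    refine Finset.sum_le_sum fun d hd => ?_
    obtain ⟨-, q, hq, hqd, hqz⟩ := Finset.mem_filter.1 hd
    have hqmem : q ∈ (Nat.primesLE ⌊z⌋₊).filter (fun q => q ∣ d) :=
      Finset.mem_filter.2 ⟨Nat.mem_primesLE.2 ⟨Nat.le_floor hqz, hq⟩, hqd⟩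
    exact Finset.single_le_sum (f := fun _ => F d) (fun _ _ => hF0 d) hqmem
  refine h1.trans ?_
  rw [Finset.sum_comm' (t' := Nat.primesLE ⌊z⌋₊) (s' := fun q => Bad.filter (fun d => q ∣ d))
    (fun q d => by simp only [Finset.mem_filter]; tauto)]
  have hRHS : 2 * c * (∑ q ∈ Nat.primesLE ⌊z⌋₊, mw σ x q / q) * ∑ d ∈ Dset W y, F d =
      ∑ q ∈ Nat.primesLE ⌊z⌋₊, 2 * c * (mw σ x q / q) * ∑ d ∈ Dset W y, F d := by
    rw [Finset.mul_sum (s := Nat.primesLE ⌊z⌋₊), Finset.sum_mul (s := Nat.primesLE ⌊z⌋₊)]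
  rw [hRHS]
  refine Finset.sum_le_sum fun q hq => ?_
  have hqp : q.Prime := (Nat.mem_primesLE.1 hq).2
  -- the fibre: either `q ∣ W` (empty) or `q ≥ 2c`
  by_cases hqW : q ∣ W
  · have : Bad.filter (fun d => q ∣ d) = ∅ := by
      ext d
      simp only [Finset.mem_filter, Finset.notMem_empty, iff_false, not_and, hBad, mem_Dset]
      intro h hqd
      exact hqp.one_lt.ne' (Nat.Coprime.eq_one_of_dvd (h.1.2.coprime_dvd_left hqd) hqW)
    rw [this, Finset.sum_empty]
    exact mul_nonneg (mul_nonneg (by positivity) (div_nonneg (mw_nonneg hσ hx q) (Nat.cast_nonneg _)))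
      (Finset.sum_nonneg fun d _ => hF0 d)
  · calc ∑ d ∈ Bad.filter (fun d => q ∣ d), F d ≤ ∑ d ∈ (Dset W y).filter (fun d => q ∣ d), F d :=
          Finset.sum_le_sum_of_subset_of_nonneg (Finset.filter_subset_filter _ (Finset.filter_subset _ _)) fun d _ _ => hF0 d
      _ ≤ (2 * c * mw σ x q / q) * ∑ d ∈ Dset W y, F d := sum_Fw_dvd_le hc hσ hx hqp (hWc q hqp hqW)
      _ = 2 * c * (mw σ x q / q) * ∑ d ∈ Dset W y, F d := by ring

/-- A list of naturals all `≥ c ≥ 0` (real) has product `≥ c^{length}`. [folklore] -/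
theorem pow_length_le_prod {c : ℝ} (hc : 0 ≤ c) : ∀ (l : List ℕ), (∀ p ∈ l, c ≤ (p : ℝ)) → c ^ l.length ≤ ((l.prod : ℕ) : ℝ)
  | [], _ => by simp
  | p :: l, h => by
    rw [List.length_cons, pow_succ, List.prod_cons, Nat.cast_mul, mul_comm ((p : ℕ) : ℝ)]
    exact mul_le_mul (pow_length_le_prod hc l fun q hq => h q (List.mem_cons_of_mem _ hq)) (h p List.mem_cons_self) hc
      (Nat.cast_nonneg _)

/-- (S3) **`Σ_{d ∈ Dset} G(d) ≤ y²`** when every prime `p ∤ W` has `p ≥ c` (`c ≥ 0`, `σ ≥ 0`, `x ≥ 1`, `y ≥ 0`).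
[cite: Polymath8b2014, proof of Prop. 4.2, p. 15] -/
theorem sum_Gw_le (hc : 0 ≤ c) (hσ : 0 ≤ σ) (hx : 1 ≤ x) (hy : 0 ≤ y) (hWc : ∀ p : ℕ, p.Prime → ¬ p ∣ W → c ≤ p) :
    ∑ d ∈ Dset W y, Gw c σ x d ≤ y ^ 2 := by
  have hterm : ∀ d ∈ Dset W y, Gw c σ x d ≤ y := by
    intro d hd
    rw [mem_Dset] at hd
    obtain ⟨⟨hd1, hdy⟩, hcop⟩ := hd
    have hd0 : d ≠ 0 := by omega
    rw [Gw_apply hd0]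
    have hprod : ∏ p ∈ d.primeFactors, mw σ x p ≤ 1 :=
      Finset.prod_le_one (fun p _ => mw_nonneg hσ hx p) fun p _ => mw_le_one σ x p
    have hpow : c ^ Ω d ≤ d := by
      rw [ArithmeticFunction.cardFactors_apply]
      have h := pow_length_le_prod hc d.primeFactorsList fun p hp => hWc p (Nat.prime_of_mem_primeFactorsList hp) fun hpW =>
        (Nat.prime_of_mem_primeFactorsList hp).one_lt.ne'
          (Nat.Coprime.eq_one_of_dvd (hcop.coprime_dvd_left (Nat.dvd_of_mem_primeFactorsList hp)) hpW)
      rwa [Nat.prod_primeFactorsList hd0] at h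
    calc c ^ Ω d * ∏ p ∈ d.primeFactors, mw σ x p ≤ (d : ℝ) * 1 :=
          mul_le_mul hpow hprod (Finset.prod_nonneg fun p _ => mw_nonneg hσ hx p) (Nat.cast_nonneg _)
      _ ≤ y := by rw [mul_one]; exact le_trans (by exact_mod_cast hdy) (Nat.floor_le hy)
  calc ∑ d ∈ Dset W y, Gw c σ x d ≤ ∑ _d ∈ Dset W y, y := Finset.sum_le_sum hterm
    _ = (Dset W y).card * y := by rw [Finset.sum_const, nsmul_eq_mul]
    _ ≤ y * y := by
        refine mul_le_mul_of_nonneg_right ?_ hy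
        calc ((Dset W y).card : ℝ) ≤ (Finset.Icc 1 ⌊y⌋₊).card := by exact_mod_cast Finset.card_filter_le _ _
          _ = ⌊y⌋₊ := by simp
          _ ≤ y := Nat.floor_le hy
    _ = y ^ 2 := by ring

end DSums

end EulerSums

end Literature.NumberTheory.Sieve
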